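/-
Copyright: b2b-lace cell (CriticalPhenomena). Text-final: enum1-g74 desk draft 1 (04d96e78a84b5fbf) + header relabel ONLY, filed by
the enum1 seat on the LEAD's FILE-WHEN-CLEAR word under REFEREE v221 R1436 (conditions (a)–(e)) after the lean1 hash read and the
referee pre-read of these bytes.  Imports LANDED and BUILT tree modules only (`NobleBoundsN1Class20`, `NoblePercLettersTransport`)
+ `HarnessLib`; no numeral; d-generic; no cited hypothesis; no value.  No x-space assembly consuming this estimate is part of this file.
-/
import Literature.Probability.FitznerVanDerHofstad2017.NobleBoundsN1Class20
import Literature.Probability.FitznerVanDerHofstad2017.NoblePercLettersTransport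
import HarnessLib

/-!
# [FvdH17] §6.1, class `(a,b) = (≥2,0)` of (6.4) at `N = 1` — the REGROUPED event-level estimate

CITATION HEADER (PLACEMENT v2). This module is part of a certified REPRODUCTION of:
R. Fitzner, R. van der Hofstad, *Mean-field behavior for nearest-neighbor percolation in `d > 10`*, Electron. J.
Probab. **22** (2017) no. 43 [FvdH17] (arXiv:1506.07977v2; LaTeX source `PercPaper_arxiv2017.tex`, "TeX l.";
extended-appendix source `AdditionalBoundForLongVersion.tex`, "ext. TeX l."): §6.1 "Bound on `Ξ^{(1)}`", display (6.4)
and the case analysis "Case `a ≥ 2`" / "Case `a ≥ 2, b = 0`" (v2 pp. 58–59, TeX l.9876–9927); §4.4 (4.65) and the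
sentence after it (p. 43); §4.2 (4.1), Def. 4.1 (4.14)–(4.17) and the sentence after (4.17) (pp. 34–36); App. B display
"double-open triangle `Ā^{ι,a,b}`" (p. 78) and Table "definition of `P^b`" (p. 73); §5.1 Table `P^{E,b}` (p. 47);
App. C.1 "Improvement of differences: Split of weight", the discussion of the right-trivial diagram `t = z = x`, Case d)
"Remaining cases", display (C.5), first term (pp. 79–80; ext. TeX l.65–67) — used here ONLY AS THE LOCATOR OF THE
GROUPING (which witnessed lines form the closed square and which the open bubble), never as the source of a letter
inequality.  Origin: build `lace` (host summit CriticalPhenomena); node N76, B12″ stage 1 (W-7a), the event-level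
companion of `NobleBoundsN1Class20`.

WHAT THIS FILE DOES.  `NobleBoundsN1Class20.jointWit_cls_2_0` bounds `J(v−u)·ℙ_p^{⊗2}(jointWit ∩ class (2,0))` by the
three-piece product `P^{S,2}(u,w)·Ā'^{ι,2,0}(u,w,t,z)·P^{E,0}(t−x,z−x)` of (6.4) with the grouping LEFT = entry triangle
`{0 ←1→ u}₀, {u ←2→ w}₀, {w ←1→ 0}₀`, MIDDLE = `{u ←1̲→ u+e_ι}₀ ⊛ {u+e_ι ←1→ t}₁ ⊛ {t ↔ w}₀`, RIGHT = `{t↔x}₁, {z↔x}₁`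
(on the class `t = z`, `u ≠ w`, the bond `(u,w)` is closed on level `0`).  On the sub-event `w ≠ 0, t ≠ w` the SAME eight
witnessed lines and the SAME pivotal bond can be grouped a second way — the grouping in which App. C.1 Case d) prints
the first term of (C.5), `‖w‖₂² 𝓑_{1,1}(−w,u−w) 𝓢_{1̲,1,1,2}(e_ι,t−u,w−u,0)`:
* LEFT′ = `{w ←1→ 0}₀ ⊛ {0 ←1→ u}₀` — the two sides of the entry triangle through `0`, an OPEN chain from `w` to `u`:
  `ℙ^{⊗2} ≤ 𝓑_{1,1}(−w, u−w)` (`NoblePercLettersTransport.piPerc_two_genDisjOcc_le_B`, base point `w`; (4.16));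
* MIDDLE′ = `{u ←1̲→ u+e_ι}₀ ⊛ {u+e_ι ←1→ t}₁ ⊛ {t ←1→ w}₀ ⊛ {w ←2→ u}₀` — the CLOSED chain through the pivotal bond
  whose fourth side is the entry triangle's doubled side: `ℙ^{⊗2} ≤ 𝓢_{1̲,1,1,2}(e_ι, t−u, w−u, 0)`
  (`piPerc_two_genDisjOcc_le_S`, base point `u`; the sentence after (4.17));
* RIGHT = `{t↔x}₁, {z↔x}₁`: `ℙ^{⊗2} ≤ P^{E,0}(t−x, z−x)` (`NobleBoundsN1ClassTools.piPerc_end_zero_le_blockPE`), unchanged.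
The regrouping is ADMISSIBLE for the grouped BK inequality exactly as the original grouping is: its only cross-level group
MIDDLE′ contains ONE level-`1` line, `{u+e_ι ↔ t}`, whose witness is bond-disjoint from every level-`0` witness
(`NobleJointTwoLevel.JointWitnessed`); the witness pools are those of `NobleBoundsN1Class20` (sub-case `w ≠ 0`),
re-assigned (`NobleBoundsN1ClassTools.mem_genDisjOccGrouped_of_pools₃`, `piPerc_genDisjOccGrouped_tag3_le`; bond
absorption `ofReal_mul_piPerc_preimage_eraseAt0`).  Results:
* `jointWit_cls_2_0_regrouped`:
  `J(v−u)·ℙ_p^{⊗2}(jointWit u v w z t x ∩ class (2,0) ∩ {w ≠ 0} ∩ {t ≠ w})`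
  `≤ Σ_ι 𝟙{v = u+e_ι} · 𝓑_{1,1}(−w, u−w) · 𝓢_{1̲,1,1,2}(e_ι, t−u, w−u, 0) · P^{E,0}(t−x, z−x)`;
* `jointWit_cls_2_0_regrouped_diag`, the diagonal companion `t = w`: the line `{t ↔ w}₀` is trivial and the middle
  chain closes as the three-line chain `u → u+e_ι → w → u`, `≤ 𝓣_{1̲,1,2}(e_ι, w−u, 0)` ((4.17)).
Every inequality used is an EVENT inclusion, the grouped BK inequality, or "`ℙ^{⊗2}` of a chain of witnessed lines is at
most its repulsive letter" ((4.16)–(4.17) and the sentence after (4.17)); no letter of print is compared with another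
letter of print; no value; no dimension; no hypothesis beyond the displayed objects.

DIAGONAL CONVENTION (GAPS G-D98).  The masks `{w ≠ 0}`, `{t ≠ w}` / `{t = w}` are the TREE's bookkeeping of the
sub-events on which the level-`0` lines `{0 ↔ w}`, `{t ↔ w}` are non-trivial; print's (6.4) and App. B sum the diagonal
and off-diagonal members together, and App. C.1 prints no case for the diagonal `t = w` — nothing here asserts that
print separates them; the diagonal companion carries no App. C.1 letter.
-/

namespace Literature.Probability.FitznerVanDerHofstad2017

open Literature.Barriers.CriticalPhenomena Literature.Probability.Percolation Literature.Probability.LatticeModels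
open Literature.Probability.FitznerVanDerHofstad2017.NobleBlocks MeasureTheory
open Literature.Probability.FitznerVanDerHofstad2017.NobleBlocks.LenIdx
open scoped ENNReal BigOperators

variable {d : ℕ}

/-- Bookkeeping for the regrouped class `(2,0)`, sub-event `w ≠ 0, t ≠ w`: LEFT′ `![{w←1→0}₀, {0←1→u}₀]` served by
`K₀ 1, K₀ 0`; MIDDLE′ `![{u←1̲→v}₀, {v←1→t}₁, {t←1→w}₀, {w←2→u}₀]` by `{b₀}, K₁ 0, K₀ 3, K₀ 2`; RIGHT by `K₁ 2, K₁ 3`.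
Pools as in `NobleBoundsN1Class20.src20n`: level `0` = `Sum.elim K₀ ![{b₀}]`, repulsive level `1` = `![K₁ 0]`, free
level `1` = `![K₁ 2, K₁ 3]`. [folklore] -/
private def src20r : Fin 2 ⊕ (Fin 4 ⊕ Fin 2) → (Fin 4 ⊕ Fin 1) ⊕ (Fin 1 ⊕ Fin 2) :=
  Sum.elim ![Sum.inl (Sum.inl 1), Sum.inl (Sum.inl 0)]
    (Sum.elim ![Sum.inl (Sum.inr 0), Sum.inr (Sum.inl 0), Sum.inl (Sum.inl 3), Sum.inl (Sum.inl 2)]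
      ![Sum.inr (Sum.inr 0), Sum.inr (Sum.inr 1)])

/-- Bookkeeping for the diagonal companion `t = w`: MIDDLE‴ `![{u←1̲→v}₀, {v←1→w}₁, {w←2→u}₀]` served by
`{b₀}, K₁ 0, K₀ 2`; LEFT′ and RIGHT as in `src20r`. [folklore] -/
private def src20rd : Fin 2 ⊕ (Fin 3 ⊕ Fin 2) → (Fin 4 ⊕ Fin 1) ⊕ (Fin 1 ⊕ Fin 2) :=
  Sum.elim ![Sum.inl (Sum.inl 1), Sum.inl (Sum.inl 0)]
    (Sum.elim ![Sum.inl (Sum.inr 0), Sum.inr (Sum.inl 0), Sum.inl (Sum.inl 2)]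
      ![Sum.inr (Sum.inr 0), Sum.inr (Sum.inr 1)])

/-- The witnesses of a point of `{b₀ open} ∩ (jointWit ∩ class (2,0))` with the facts both members use (the block
`hwit` of `NobleBoundsN1Class20.jointWit_cls_2_0`, verbatim): level-`0` witnesses `K₀` and the bond `b₀` pairwise
disjoint, level-`1` witnesses `K₁` pairwise disjoint, the witness of `{v ↔ t}` off every level-`0` witness and off
`b₀`, the lines they witness (`t = z` on the class), and the closed bond `(u,w)` off every `K₀ j`.
[cite: FitznerVanDerHofstad2017, §4.4 after (4.65) (arXiv:1506.07977v2 p. 43); §6.1 "Case a ≥ 2" (p. 59)] -/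
private theorem cls20_wit {u v w z t x : Site d} {ω : Fin 2 → BondConfig (Site d)}
    (hω : ω ∈ {ω : Fin 2 → BondConfig (Site d) | s(u, v) ∈ ω 0} ∩ (jointWit u v w z t x ∩ clsSet u w t z 2 0)) :
    ∃ K₀ K₁ : Fin 4 → Set (Sym2 (Site d)),
      (∀ j, K₀ j ⊆ ω 0) ∧ (∀ j, K₁ j ⊆ ω 1) ∧
      (Pairwise fun a a' => Disjoint (Sum.elim K₀ ![({s(u, v)} : Set (Sym2 (Site d)))] a)
        (Sum.elim K₀ ![{s(u, v)}] a')) ∧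
      (Pairwise fun i j => Disjoint (K₁ i) (K₁ j)) ∧ (∀ j, Disjoint (K₀ j) (K₁ 0)) ∧
      Disjoint ({s(u, v)} : Set (Sym2 (Site d))) (K₁ 0) ∧ s(u, v) ∈ ω 0 ∧
      K₀ 0 ∈ (openConn 0 u : Set (BondConfig (Site d))) ∧ K₀ 1 ∈ (openConn 0 w : Set (BondConfig (Site d))) ∧
      K₀ 2 ∈ (openConn w u : Set (BondConfig (Site d))) ∧ K₀ 3 ∈ (openConn t w : Set (BondConfig (Site d))) ∧
      K₁ 0 ∈ (openConn v t : Set (BondConfig (Site d))) ∧ K₁ 2 ∈ (openConn x t : Set (BondConfig (Site d))) ∧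
      K₁ 3 ∈ (openConn x t : Set (BondConfig (Site d))) ∧ (∀ j, s(u, w) ∉ K₀ j) := by
  obtain ⟨hb0, hjw, hcls⟩ := hω
  obtain ⟨-, K₀, K₁, h₀, h₁, hA₀, hA₁, hd₀, hd₁, hc₀, -, -⟩ := (mem_jointWit_iff u v w z t x ω).1 hjw
  have hclosed : s(u, w) ∉ ω 0 := ((mem_lineCls_two_iff u w 0 ω).1 hcls.1).2
  have hzt : t = z := (mem_lineCls_zero_iff t z 1 ω).1 hcls.2
  have hK₀ω : ∀ j, K₀ j ⊆ ω 0 := fun j => (h₀ j).trans (offBonds_subset _ _)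
  have hK₁ω : ∀ j, K₁ j ⊆ ω 1 := fun j => (h₁ j).trans (offBonds_subset _ _)
  have hb₀K₀ : ∀ j, Disjoint (K₀ j) {s(u, v)} := fun j => Set.disjoint_singleton_right.2 fun h => by
    have h' := h₀ j h; rw [offBonds_def] at h'; exact h'.2 rfl
  have hb₀K₁ : Disjoint ({s(u, v)} : Set (Sym2 (Site d))) (K₁ 0) :=
    Set.disjoint_singleton_left.2 fun h => by
      have h' := h₁ 0 h; rw [offBonds_def] at h'
      exact h'.2 ((mem_bondsAt_singleton_iff u _).2 (Sym2.mem_mk_left u v))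
  have hK03 : K₀ 3 ∈ (openConn w z : Set (BondConfig (Site d))) := hA₀ 3
  have hK12 : K₁ 2 ∈ (openConn t x : Set (BondConfig (Site d))) := hA₁ 2
  have hK13 : K₁ 3 ∈ (openConn z x : Set (BondConfig (Site d))) := hA₁ 3
  refine ⟨K₀, K₁, hK₀ω, hK₁ω, pairwise_disjoint_pool₀ hd₀ hb₀K₀, hd₁, fun j => (hc₀ j).symm, hb₀K₁, hb0,
    hA₀ 0, hA₀ 1, hA₀ 2, ?_, hA₁ 0, SimpleGraph.Reachable.symm hK12, ?_, fun j h => hclosed (hK₀ω j h)⟩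
  · rw [← hzt] at hK03; exact SimpleGraph.Reachable.symm hK03
  · rw [← hzt] at hK13; exact SimpleGraph.Reachable.symm hK13

/-- **[FvdH17] §6.1, class `(≥2,0)` of (6.4) at `N = 1`, REGROUPED on the sub-event `w ≠ 0, t ≠ w`** (open bubble
from the weighted vertex `w`, closed square through the pivotal bond):
`J(v−u)·ℙ_p^{⊗2}(jointWit u v w z t x ∩ class (2,0) ∩ {w ≠ 0} ∩ {t ≠ w})`
`≤ Σ_ι 𝟙{v = u+e_ι} · 𝓑_{1,1}(−w, u−w) · 𝓢_{1̲,1,1,2}(e_ι, t−u, w−u, 0) · P^{E,0}(t−x, z−x)`.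
The SAME witnessed lines and pivotal bond as `NobleBoundsN1Class20.jointWit_cls_2_0`, grouped LEFT′ = `{w ←1→ 0}₀ ⊛
{0 ←1→ u}₀`, MIDDLE′ = `{u ←1̲→ u+e_ι}₀ ⊛ {u+e_ι ←1→ t}₁ ⊛ {t ←1→ w}₀ ⊛ {w ←2→ u}₀`, RIGHT = `{t↔x}₁, {z↔x}₁`; only
event inclusions, the grouped BK inequality and (4.16)–(4.17) are used — no letter of print is compared with another.
(GAPS G-D98: the masks `{w ≠ 0}`, `{t ≠ w}` are the tree's bookkeeping of the sub-event on which the level-`0` lines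
`{0 ↔ w}`, `{t ↔ w}` are non-trivial; print sums the diagonal `t = w` and this member together and App. C.1 prints no
case for the diagonal — the locator below names where print DISPLAYS this grouping, nothing more.)
[cite: FitznerVanDerHofstad2017, §6.1 (6.4) "Case a ≥ 2, b = 0" (arXiv:1506.07977v2 p. 59); §4.2 Def. 4.1 (4.16)–(4.17) and the sentence after (4.17) (p. 36); §4.4 after (4.65) (p. 43); App. C.1 Case d) "Remaining cases", (C.5) first term (pp. 79–80; ext. TeX l.65–67) — LOCATOR OF THE GROUPING only] -/
theorem jointWit_cls_2_0_regrouped (p : unitInterval) (x u v w z t : Site d) :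
    ENNReal.ofReal (bondJ d p (v - u)) *
        piPerc d p 2 (jointWit u v w z t x ∩ clsSet u w t z 2 0 ∩ {_ω | w ≠ 0} ∩ {_ω | t ≠ w}) ≤
      ∑ ι : Fin d × Bool, (if v = u + stepVec ι then (1 : ℝ≥0∞) else 0) *
        ((Letters.perc d p).B (ge 1) (ge 1) (-w) (u - w) *
          (Letters.perc d p).S (eq 1) (ge 1) (ge 1) (ge 2) (stepVec ι) (t - u) (w - u) 0 *
          blockPE (Letters.perc d p) 0 (t - x) (z - x)) := by
  classical
  -- the masks: off the sub-event `w ≠ 0, t ≠ w` the event is empty; on it the masks are the whole space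
  by_cases hmask : w ≠ 0 ∧ t ≠ w
  swap
  · have hsub : jointWit u v w z t x ∩ clsSet u w t z 2 0 ∩ {_ω | w ≠ 0} ∩ {_ω | t ≠ w} ⊆
        (∅ : Set (Fin 2 → BondConfig (Site d))) := fun ω h => hmask ⟨h.1.2, h.2⟩
    rw [Set.eq_empty_of_subset_empty hsub, measure_empty, mul_zero]; exact zero_le
  obtain ⟨hw0, htw⟩ := hmask
  have hFeq : jointWit u v w z t x ∩ clsSet u w t z 2 0 ∩ {_ω | w ≠ 0} ∩ {_ω | t ≠ w} =
      jointWit u v w z t x ∩ clsSet u w t z 2 0 :=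
    Set.ext fun ω => ⟨fun h => h.1.1, fun h => ⟨⟨h, hw0⟩, htw⟩⟩
  rw [hFeq]
  set F := jointWit u v w z t x ∩ clsSet u w t z 2 0 with hF
  -- the bond factor `J(v - u)`
  by_cases hadj : (zdGraph d).Adj 0 (v - u)
  swap
  · rw [ofReal_bondJ_eq_zero_of_not_adj p hadj, zero_mul]; exact zero_le
  obtain ⟨ι₀, hι₀⟩ := (zdGraph_adj_iff_stepVec 0 (v - u)).1 hadj
  have hv : v = u + stepVec ι₀ := by rw [zero_add] at hι₀; exact sub_eq_iff_eq_add'.1 hι₀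
  have huv : u ≠ v := by rintro rfl; rw [sub_self] at hadj; exact hadj.ne rfl
  have he : s(u, v) ∈ (zdGraph d).edgeSet :=
    (SimpleGraph.mem_edgeSet _).2 ((zdGraph_adj_iff_stepVec u v).2 ⟨ι₀, hv⟩)
  rw [bondJ_def, if_pos hadj]
  -- an empty class contributes nothing; otherwise read off the side conditions
  by_cases hne : F.Nonempty
  swap
  · rw [Set.not_nonempty_iff_eq_empty.1 hne, measure_empty, mul_zero]; exact zero_le
  obtain ⟨ω₀, hjw₀, hcls₀⟩ := hne
  obtain ⟨⟨h0w, -, -, hzv, htu, -, -⟩, -⟩ := (mem_jointWit_iff u v w z t x ω₀).1 hjw₀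
  have huw : u ≠ w := ((mem_lineCls_two_iff u w 0 ω₀).1 hcls₀.1).1
  have hzt : t = z := (mem_lineCls_zero_iff t z 1 ω₀).1 hcls₀.2
  have hu0 : u ≠ 0 := fun h => huw (h.trans (h0w h).symm)
  have htv : t ≠ v := fun h => hzv (hzt ▸ h)
  have hvt : v ≠ t := fun h => htv h.symm
  -- the `ι`-sum is at least its `ι₀` term
  refine le_trans ?_ (term_le_sum_ite ι₀ hv _)
  -- absorb `p` as the open bond `b₀` on level `0`
  have hFm : MeasurableSet F := (measurableSet_jointWit u v w z t x).inter (measurableSet_clsSet u w t z 2 0)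
  have habs := ofReal_mul_piPerc_preimage_eraseAt0 p he hFm
  rw [hF, eraseAt0_preimage_jointWit_inter_clsSet, ← hF] at habs
  rw [habs]
  -- the three regrouped line families and their configurations
  set AS : Fin 2 → Set (BondConfig (Site d)) := ![event (ge 1) w 0, event (ge 1) 0 u] with hAS
  set AM : Fin 4 → Set (BondConfig (Site d)) :=
    ![event (eq 1) u v, event (ge 1) v t, event (ge 1) t w, event (ge 2) w u] with hAM
  set AE : Fin 2 → Set (BondConfig (Site d)) := ![event (ge 0) x t, event (ge 0) x t] with hAE
  set cS : Fin 2 → Fin 2 := ![0, 0] with hcS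
  set cM : Fin 4 → Fin 2 := ![0, 1, 0, 0] with hcM
  set cE : Fin 2 → Fin 2 := ![1, 1] with hcE
  have hfS : ∀ i, IsFinitary (AS i) := fun i => by
    rw [hAS]; fin_cases i; exacts [isFinitary_event (ge 1) w 0, isFinitary_event (ge 1) 0 u]
  have hfM : ∀ i, IsFinitary (AM i) := fun i => by
    rw [hAM]; fin_cases i
    exacts [isFinitary_event (eq 1) u v, isFinitary_event (ge 1) v t, isFinitary_event (ge 1) t w,
      isFinitary_event (ge 2) w u]
  have hfE : ∀ i, IsFinitary (AE i) := fun i => by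
    rw [hAE]; fin_cases i; exacts [isFinitary_event (ge 0) x t, isFinitary_event (ge 0) x t]
  -- letter side: open chain `w → 0 → u`, closed chain `u → v → t → w → u`, exit block
  have hS : piPerc d p 2 (genDisjOcc AS cS) ≤ (Letters.perc d p).B (ge 1) (ge 1) (-w) (u - w) := by
    have h := piPerc_two_genDisjOcc_le_B p (ge 1) (ge 1) w 0 u cS
    rwa [zero_sub] at h
  have hM : piPerc d p 2 (genDisjOcc AM cM) ≤
      (Letters.perc d p).S (eq 1) (ge 1) (ge 1) (ge 2) (stepVec ι₀) (t - u) (w - u) 0 := by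
    have h := piPerc_two_genDisjOcc_le_S p (eq 1) (ge 1) (ge 1) (ge 2) u v t w u cM
    rwa [hι₀, zero_add, sub_self] at h
  have hE : piPerc d p 2 (genDisjOcc AE cE) ≤ blockPE (Letters.perc d p) 0 (t - x) (z - x) :=
    piPerc_end_zero_le_blockPE p hzt.symm cE rfl
  -- event side: the witness pools of `NobleBoundsN1Class20` (sub-case `w ≠ 0`), re-assigned by `src20r`
  have hincl : {ω : Fin 2 → BondConfig (Site d) | s(u, v) ∈ ω 0} ∩ F ⊆
      genDisjOccGrouped (Sum.elim AS (Sum.elim AM AE)) (Sum.elim cS (Sum.elim cM cE)) tag3 := by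
    intro ω hω
    obtain ⟨K₀, K₁, hK₀ω, hK₁ω, hPd, hd₁, hc₀, hb₀K₁, hb0, hK00, hK01, hK02, hK03, hK10, hK12, hK13, huwK⟩ :=
      cls20_wit hω
    refine mem_genDisjOccGrouped_of_pools₃ _ _ _ ω (Sum.elim K₀ ![({s(u, v)} : Set (Sym2 (Site d)))])
      ![K₁ 0] ![K₁ 2, K₁ 3] ?_ ?_ ?_ hPd ?_ ?_ src20r (by decide) (by decide) ?_ (by decide)
    · rintro (a | a)
      · exact hK₀ω a
      · fin_cases a; exact Set.singleton_subset_iff.2 hb0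
    · intro b; fin_cases b; exact hK₁ω 0
    · intro r; fin_cases r
      · exact hK₁ω 2
      · exact hK₁ω 3
    · rintro (b | b) (b' | b') hbb' <;> fin_cases b <;> fin_cases b' <;> simp at hbb' ⊢ <;> exact hd₁ (by decide)
    · rintro (a | a) b <;> fin_cases b
      · exact hc₀ a
      · fin_cases a; exact hb₀K₁
    · rintro (i | i | i) <;> fin_cases i
      · show K₀ 1 ∈ (event (ge 1) w 0 : Set (BondConfig (Site d)))
        rw [event_ge, openConnGe_one_eq hw0]; exact SimpleGraph.Reachable.symm hK01
      · show K₀ 0 ∈ (event (ge 1) 0 u : Set (BondConfig (Site d)))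
        rw [event_ge, openConnGe_one_eq hu0.symm]; exact hK00
      · show ({s(u, v)} : Set (Sym2 (Site d))) ∈ (event (eq 1) u v : Set (BondConfig (Site d)))
        rw [event_eq]; exact mem_openConnEq_one_of_mem huv (Set.mem_singleton _)
      · show K₁ 0 ∈ (event (ge 1) v t : Set (BondConfig (Site d)))
        rw [event_ge, openConnGe_one_eq hvt]; exact hK10
      · show K₀ 3 ∈ (event (ge 1) t w : Set (BondConfig (Site d)))
        rw [event_ge, openConnGe_one_eq htw]; exact hK03
      · show K₀ 2 ∈ (event (ge 2) w u : Set (BondConfig (Site d)))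
        rw [event_ge]
        exact mem_openConnGe_two_of_notMem hK02 huw.symm fun h => huwK 2 (by rw [Sym2.eq_swap]; exact h)
      · show K₁ 2 ∈ (event (ge 0) x t : Set (BondConfig (Site d)))
        rw [event_ge, openConnGe_zero]; exact hK12
      · show K₁ 3 ∈ (event (ge 0) x t : Set (BondConfig (Site d)))
        rw [event_ge, openConnGe_zero]; exact hK13
  calc piPerc d p 2 ({ω : Fin 2 → BondConfig (Site d) | s(u, v) ∈ ω 0} ∩ F)
      ≤ piPerc d p 2 (genDisjOccGrouped (Sum.elim AS (Sum.elim AM AE)) (Sum.elim cS (Sum.elim cM cE)) tag3) :=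
        measure_mono hincl
    _ ≤ piPerc d p 2 (genDisjOcc AS cS) * piPerc d p 2 (genDisjOcc AM cM) * piPerc d p 2 (genDisjOcc AE cE) :=
        piPerc_genDisjOccGrouped_tag3_le p AS AM AE cS cM cE hfS hfM hfE
    _ ≤ _ := mul_le_mul' (mul_le_mul' hS hM) hE

/-- **The diagonal companion `t = w`** of `jointWit_cls_2_0_regrouped`: on `jointWit ∩ class (2,0) ∩ {w ≠ 0} ∩ {t = w}`
the level-`0` line `{t ↔ w}` is trivial and the chain through the pivotal bond closes with three lines,
`{u ←1̲→ u+e_ι}₀ ⊛ {u+e_ι ←1→ w}₁ ⊛ {w ←2→ u}₀ ≤ 𝓣_{1̲,1,2}(e_ι, w−u, 0)` ((4.17)):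
`J(v−u)·ℙ_p^{⊗2}(…) ≤ Σ_ι 𝟙{v = u+e_ι} · 𝓑_{1,1}(−w, u−w) · 𝓣_{1̲,1,2}(e_ι, w−u, 0) · P^{E,0}(t−x, z−x)`.
(GAPS G-D98: this is the diagonal member `t = w` of the TREE's bookkeeping; print's (6.4) and App. B carry it inside
the class `(2,0)` and App. C.1 prints no case for the diagonal — the triangle is the (4.17) letter of the three-line
chain, not a letter of App. C.1.)
[cite: FitznerVanDerHofstad2017, §6.1 (6.4) "Case a ≥ 2, b = 0" (arXiv:1506.07977v2 p. 59); §4.2 Def. 4.1 (4.16)–(4.17) (p. 36); §4.4 after (4.65) (p. 43)] -/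
theorem jointWit_cls_2_0_regrouped_diag (p : unitInterval) (x u v w z t : Site d) :
    ENNReal.ofReal (bondJ d p (v - u)) *
        piPerc d p 2 (jointWit u v w z t x ∩ clsSet u w t z 2 0 ∩ {_ω | w ≠ 0} ∩ {_ω | t = w}) ≤
      ∑ ι : Fin d × Bool, (if v = u + stepVec ι then (1 : ℝ≥0∞) else 0) *
        ((Letters.perc d p).B (ge 1) (ge 1) (-w) (u - w) *
          (Letters.perc d p).T (eq 1) (ge 1) (ge 2) (stepVec ι) (w - u) 0 *
          blockPE (Letters.perc d p) 0 (t - x) (z - x)) := by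
  classical
  -- the masks
  by_cases hmask : w ≠ 0 ∧ t = w
  swap
  · have hsub : jointWit u v w z t x ∩ clsSet u w t z 2 0 ∩ {_ω | w ≠ 0} ∩ {_ω | t = w} ⊆
        (∅ : Set (Fin 2 → BondConfig (Site d))) := fun ω h => hmask ⟨h.1.2, h.2⟩
    rw [Set.eq_empty_of_subset_empty hsub, measure_empty, mul_zero]; exact zero_le
  obtain ⟨hw0, htw⟩ := hmask
  have hFeq : jointWit u v w z t x ∩ clsSet u w t z 2 0 ∩ {_ω | w ≠ 0} ∩ {_ω | t = w} =
      jointWit u v w z t x ∩ clsSet u w t z 2 0 :=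
    Set.ext fun ω => ⟨fun h => h.1.1, fun h => ⟨⟨h, hw0⟩, htw⟩⟩
  rw [hFeq]
  set F := jointWit u v w z t x ∩ clsSet u w t z 2 0 with hF
  -- the bond factor `J(v - u)`
  by_cases hadj : (zdGraph d).Adj 0 (v - u)
  swap
  · rw [ofReal_bondJ_eq_zero_of_not_adj p hadj, zero_mul]; exact zero_le
  obtain ⟨ι₀, hι₀⟩ := (zdGraph_adj_iff_stepVec 0 (v - u)).1 hadj
  have hv : v = u + stepVec ι₀ := by rw [zero_add] at hι₀; exact sub_eq_iff_eq_add'.1 hι₀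
  have huv : u ≠ v := by rintro rfl; rw [sub_self] at hadj; exact hadj.ne rfl
  have he : s(u, v) ∈ (zdGraph d).edgeSet :=
    (SimpleGraph.mem_edgeSet _).2 ((zdGraph_adj_iff_stepVec u v).2 ⟨ι₀, hv⟩)
  rw [bondJ_def, if_pos hadj]
  -- an empty class contributes nothing; otherwise read off the side conditions
  by_cases hne : F.Nonempty
  swap
  · rw [Set.not_nonempty_iff_eq_empty.1 hne, measure_empty, mul_zero]; exact zero_le
  obtain ⟨ω₀, hjw₀, hcls₀⟩ := hne
  obtain ⟨⟨h0w, -, -, hzv, htu, -, -⟩, -⟩ := (mem_jointWit_iff u v w z t x ω₀).1 hjw₀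
  have huw : u ≠ w := ((mem_lineCls_two_iff u w 0 ω₀).1 hcls₀.1).1
  have hzt : t = z := (mem_lineCls_zero_iff t z 1 ω₀).1 hcls₀.2
  have hu0 : u ≠ 0 := fun h => huw (h.trans (h0w h).symm)
  have htv : t ≠ v := fun h => hzv (hzt ▸ h)
  have hvt : v ≠ t := fun h => htv h.symm
  -- the `ι`-sum is at least its `ι₀` term
  refine le_trans ?_ (term_le_sum_ite ι₀ hv _)
  -- absorb `p` as the open bond `b₀` on level `0`
  have hFm : MeasurableSet F := (measurableSet_jointWit u v w z t x).inter (measurableSet_clsSet u w t z 2 0)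
  have habs := ofReal_mul_piPerc_preimage_eraseAt0 p he hFm
  rw [hF, eraseAt0_preimage_jointWit_inter_clsSet, ← hF] at habs
  rw [habs]
  -- the three line families and their configurations
  set AS : Fin 2 → Set (BondConfig (Site d)) := ![event (ge 1) w 0, event (ge 1) 0 u] with hAS
  set AM : Fin 3 → Set (BondConfig (Site d)) := ![event (eq 1) u v, event (ge 1) v w, event (ge 2) w u] with hAM
  set AE : Fin 2 → Set (BondConfig (Site d)) := ![event (ge 0) x t, event (ge 0) x t] with hAE
  set cS : Fin 2 → Fin 2 := ![0, 0] with hcS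
  set cM : Fin 3 → Fin 2 := ![0, 1, 0] with hcM
  set cE : Fin 2 → Fin 2 := ![1, 1] with hcE
  have hfS : ∀ i, IsFinitary (AS i) := fun i => by
    rw [hAS]; fin_cases i; exacts [isFinitary_event (ge 1) w 0, isFinitary_event (ge 1) 0 u]
  have hfM : ∀ i, IsFinitary (AM i) := fun i => by
    rw [hAM]; fin_cases i
    exacts [isFinitary_event (eq 1) u v, isFinitary_event (ge 1) v w, isFinitary_event (ge 2) w u]
  have hfE : ∀ i, IsFinitary (AE i) := fun i => by
    rw [hAE]; fin_cases i; exacts [isFinitary_event (ge 0) x t, isFinitary_event (ge 0) x t]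
  -- letter side
  have hS : piPerc d p 2 (genDisjOcc AS cS) ≤ (Letters.perc d p).B (ge 1) (ge 1) (-w) (u - w) := by
    have h := piPerc_two_genDisjOcc_le_B p (ge 1) (ge 1) w 0 u cS
    rwa [zero_sub] at h
  have hM : piPerc d p 2 (genDisjOcc AM cM) ≤
      (Letters.perc d p).T (eq 1) (ge 1) (ge 2) (stepVec ι₀) (w - u) 0 := by
    have h := piPerc_two_genDisjOcc_le_T p (eq 1) (ge 1) (ge 2) u v w u cM
    rwa [hι₀, zero_add, sub_self] at h
  have hE : piPerc d p 2 (genDisjOcc AE cE) ≤ blockPE (Letters.perc d p) 0 (t - x) (z - x) :=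
    piPerc_end_zero_le_blockPE p hzt.symm cE rfl
  -- event side: the same pools, re-assigned by `src20rd` (`K₀ 3`, the witness of the trivial line, unused)
  have hincl : {ω : Fin 2 → BondConfig (Site d) | s(u, v) ∈ ω 0} ∩ F ⊆
      genDisjOccGrouped (Sum.elim AS (Sum.elim AM AE)) (Sum.elim cS (Sum.elim cM cE)) tag3 := by
    intro ω hω
    obtain ⟨K₀, K₁, hK₀ω, hK₁ω, hPd, hd₁, hc₀, hb₀K₁, hb0, hK00, hK01, hK02, -, hK10, hK12, hK13, huwK⟩ :=
      cls20_wit hω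
    refine mem_genDisjOccGrouped_of_pools₃ _ _ _ ω (Sum.elim K₀ ![({s(u, v)} : Set (Sym2 (Site d)))])
      ![K₁ 0] ![K₁ 2, K₁ 3] ?_ ?_ ?_ hPd ?_ ?_ src20rd (by decide) (by decide) ?_ (by decide)
    · rintro (a | a)
      · exact hK₀ω a
      · fin_cases a; exact Set.singleton_subset_iff.2 hb0
    · intro b; fin_cases b; exact hK₁ω 0
    · intro r; fin_cases r
      · exact hK₁ω 2
      · exact hK₁ω 3
    · rintro (b | b) (b' | b') hbb' <;> fin_cases b <;> fin_cases b' <;> simp at hbb' ⊢ <;> exact hd₁ (by decide)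
    · rintro (a | a) b <;> fin_cases b
      · exact hc₀ a
      · fin_cases a; exact hb₀K₁
    · rintro (i | i | i) <;> fin_cases i
      · show K₀ 1 ∈ (event (ge 1) w 0 : Set (BondConfig (Site d)))
        rw [event_ge, openConnGe_one_eq hw0]; exact SimpleGraph.Reachable.symm hK01
      · show K₀ 0 ∈ (event (ge 1) 0 u : Set (BondConfig (Site d)))
        rw [event_ge, openConnGe_one_eq hu0.symm]; exact hK00
      · show ({s(u, v)} : Set (Sym2 (Site d))) ∈ (event (eq 1) u v : Set (BondConfig (Site d)))
        rw [event_eq]; exact mem_openConnEq_one_of_mem huv (Set.mem_singleton _)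
      · show K₁ 0 ∈ (event (ge 1) v w : Set (BondConfig (Site d)))
        rw [event_ge, ← htw, openConnGe_one_eq hvt]; exact hK10
      · show K₀ 2 ∈ (event (ge 2) w u : Set (BondConfig (Site d)))
        rw [event_ge]
        exact mem_openConnGe_two_of_notMem hK02 huw.symm fun h => huwK 2 (by rw [Sym2.eq_swap]; exact h)
      · show K₁ 2 ∈ (event (ge 0) x t : Set (BondConfig (Site d)))
        rw [event_ge, openConnGe_zero]; exact hK12
      · show K₁ 3 ∈ (event (ge 0) x t : Set (BondConfig (Site d)))
        rw [event_ge, openConnGe_zero]; exact hK13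
  calc piPerc d p 2 ({ω : Fin 2 → BondConfig (Site d) | s(u, v) ∈ ω 0} ∩ F)
      ≤ piPerc d p 2 (genDisjOccGrouped (Sum.elim AS (Sum.elim AM AE)) (Sum.elim cS (Sum.elim cM cE)) tag3) :=
        measure_mono hincl
    _ ≤ piPerc d p 2 (genDisjOcc AS cS) * piPerc d p 2 (genDisjOcc AM cM) * piPerc d p 2 (genDisjOcc AE cE) :=
        piPerc_genDisjOccGrouped_tag3_le p AS AM AE cS cM cE hfS hfM hfE
    _ ≤ _ := mul_le_mul' (mul_le_mul' hS hM) hE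

end Literature.Probability.FitznerVanDerHofstad2017
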